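import Literature.Geometry.Symplectic.AlmostComplexTangentBundleIso
import Literature.Geometry.Symplectic.CanonicalClass
import Literature.AlgebraicTopology.CharacteristicClasses.Complexification
import Literature.AlgebraicTopology.CharacteristicClasses.ConjugateBundle
import HarnessLib

/-!
# `TM ⊗ ℂ ≅ (TM, J) ⊕ (TM, J)‾` and `p₁(M) = c₁(TM, J)² - 2 c₂(TM, J)` for almost complex manifolds

Topic `Literature/Geometry/Symplectic`.  F. Hirzebruch, *Topological Methods in Algebraic Geometry*
(3rd ed. 1966), **Theorem 4.5.1** (p. 66): for a `U(q)`-bundle `ξ` with underlying real bundle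
`ρ(ξ)`, "`ψ(ρ(ξ))` \[the complexification\] is the Whitney sum of `ξ` and `ξ^*`" — proof: the
unitary matrix `( iI  I ; I  -iI )/√2` conjugates the real form of `A ∈ U(q)` to `diag(A, Ā)` —
hence "`1 - p₁ + p₂ - ⋯ = (1 + c₁ + c₂ + ⋯)(1 - c₁ + c₂ - ⋯)`", in degree four
**`p₁ = c₁² - 2 c₂`**; §4.6: applied to the tangent bundle of an almost complex manifold.  This
file proves it for the tree's almost complex manifolds `(M, J)` (`AlmostComplexStructure`), whose
complex tangent bundle `(TM, J)` is `J.complexTangentBundle` (`AlmostComplexTangentBundle`) with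
Chern classes `J.chernClass i` (`CanonicalClass`), and whose Pontryagin classes are those of
`Complexification.lean` (`tangentPontryaginClass I M i = pᵢ(TM) = (-1)ⁱ c₂ᵢ(TM ⊗ ℂ)`):

* `VectorBundleCore.continuous_linComb` — on a vector bundle core, `(a, b) ↦ c₁ a + c₂ b` is a
  continuous map `Z ×_B Z → Z` of total spaces (read in a chart: the coordinate changes are linear);
* the fibrewise splitting `splitEquiv x : T_x M ⊗ ℂ ≃_ℂ (T_x M, J_x) ⊕ (T_x M, J_x)‾`,
  `u + i v ↦ (β(u + J v), β(u - J v)‾)` with inverse `(a, b̄) ↦ ½(β⁻¹a + β⁻¹b) + i ½ J(β⁻¹b - β⁻¹a)`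
  (`β = toFiber x : T_x M ≃ ℂᵏ` the identification intertwining `J_x` and `i`,
  `complexTangentCore_fiberEquiv`) — Hirzebruch's matrix, written invariantly: the `± i`
  eigenbundles of `J ⊗ 1` on `TM ⊗ ℂ` are `{u ∓ i J u}`, and `u + i v = ½(w₊ + w₋)`…;
* **`complexifiedTangentSplitting : TM ⊗ ℂ ≅ (TM, J) ⊕ (TM, J)‾`** as complex vector bundles
  (continuity of both directions through `J.tangentHomeomorph : (TM, J) ≅ TM` of
  `AlmostComplexTangentBundleIso` and `continuous_linComb`);
* **`chernClassZ_two_complexifiedTangentBundle : c₂(TM ⊗ ℂ) = 2 c₂(TM, J) - c₁(TM, J)²`**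
  ((C₁), the Whitney formula (C₂) in degree `4`, and `c₁(ξ̄) = -c₁(ξ)`, `c₂(ξ̄) = c₂(ξ)` of
  `ConjugateBundle`), over paracompact Hausdorff `M`;
* **`tangentPontryaginClass_one_eq : p₁(M) = c₁(TM, J) ⌣ c₁(TM, J) - 2 c₂(TM, J) ∈ H⁴(M; ℤ)`**
  (degrees normalised to `4` by `degCast`; `c₁(TM, J) = J.firstChernClass`).

Everything is proved; no named facts.

## References

* F. Hirzebruch, *Topological Methods in Algebraic Geometry*, 3rd ed., Grundlehren 131, Springer
  (1966), Thm. 4.5.1 (p. 66), §4.6 (p. 67). [Hirzebruch1966]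
* J. Milnor, J. Stasheff, *Characteristic Classes*, Ann. of Math. Stud. 76 (1974), §15
  Cor. 15.5 (`1 - p₁ + p₂ - ⋯ = (1 - c₁ + c₂ - ⋯)(1 + c₁ + c₂ + ⋯)`). [MilnorStasheffAMS76]
* D. McDuff, D. Salamon, *Introduction to Symplectic Topology*, 3rd ed. (2017), §2.6–2.7
  (`(TM, J)` and its Chern classes). [McDuffSalamon2017]
* D. Husemoller, *Fibre Bundles*, 3rd ed., GTM 20 (1994), Ch. 3 §2, Ch. 17 §3. [HusemollerFibreBundles1994]
-/

noncomputable section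

open scoped Manifold ContDiff Topology ComplexConjugate
open Bundle Set Function Module Filter
open Literature.AlgebraicTopology.CharacteristicClasses Literature.AlgebraicTopology.SingularHomology

namespace Literature.Geometry.Symplectic

/-! ### Fibrewise linear combinations on a vector bundle core are continuous -/

section LinComb

variable {𝕜 : Type*} [NontriviallyNormedField 𝕜] {B : Type*} [TopologicalSpace B] {F : Type*}
  [NormedAddCommGroup F] [NormedSpace 𝕜 F] {ι : Type*} (Z : VectorBundleCore 𝕜 B F ι)

/-- **Fibrewise linear combinations are continuous on a vector bundle core**: `(a, b) ↦ c₁ a + c₂ b` is a continuous map `Z ×_B Z → Z` of total spaces — in the chart indexed by `i` it reads `(x, a', b') ↦ (x, c₁ a' + c₂ b')`, the coordinate changes being linear (Husemoller Ch. 3 §2: morphisms read in charts; the tree's `continuous_totalSpace_map`). [cite: HusemollerFibreBundles1994, Ch. 3 §2] -/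
theorem _root_.VectorBundleCore.continuous_linComb (c₁ c₂ : 𝕜) :
    Continuous (fun q : TotalSpace (F × F) (fun x ↦ Z.Fiber x × Z.Fiber x) ↦
      (⟨q.proj, c₁ • q.2.1 + c₂ • q.2.2⟩ : Z.TotalSpace)) := by
  refine continuous_totalSpace_map (F₁ := F × F) (F₂ := F) continuous_id
    (fun x (v : Z.Fiber x × Z.Fiber x) ↦ (c₁ • v.1 + c₂ • v.2 : Z.Fiber x)) fun p ↦ ?_
  set i := Z.indexAt p.proj
  have hev : (fun q : B × (F × F) ↦ c₁ • q.2.1 + c₂ • q.2.2) =ᶠ[𝓝 (trivializationAt (F × F)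
      (fun x ↦ Z.Fiber x × Z.Fiber x) p.proj p)] fun q ↦
      (trivializationAt F Z.Fiber (id p.proj) ⟨id ((trivializationAt (F × F)
        (fun x ↦ Z.Fiber x × Z.Fiber x) p.proj).toPartialEquiv.symm q).proj,
        c₁ • ((trivializationAt (F × F) (fun x ↦ Z.Fiber x × Z.Fiber x) p.proj).toPartialEquiv.symm q).2.1 +
        c₂ • ((trivializationAt (F × F) (fun x ↦ Z.Fiber x × Z.Fiber x) p.proj).toPartialEquiv.symm q).2.2⟩).2 := by
    have hopen : IsOpen {q : B × (F × F) | q.1 ∈ Z.baseSet i} :=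
      (Z.isOpen_baseSet i).preimage continuous_fst
    have hmem : (trivializationAt (F × F) (fun x ↦ Z.Fiber x × Z.Fiber x) p.proj p) ∈
        {q : B × (F × F) | q.1 ∈ Z.baseSet i} := by
      change p.proj ∈ Z.baseSet i
      exact Z.mem_baseSet_at p.proj
    filter_upwards [hopen.mem_nhds hmem] with q hq
    change q.1 ∈ Z.baseSet i at hq
    have hsymm : (trivializationAt (F × F) (fun x ↦ Z.Fiber x × Z.Fiber x) p.proj).toPartialEquiv.symm q
        = ⟨q.1, ((Z.localTriv i).symm q.1 q.2.1, (Z.localTriv i).symm q.1 q.2.2)⟩ := rfl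
    rw [hsymm]
    rw [Z.localTriv_symm_apply i hq, Z.localTriv_symm_apply i hq]
    change c₁ • q.2.1 + c₂ • q.2.2 = Z.coordChange (Z.indexAt q.1) i q.1
      (c₁ • Z.coordChange i (Z.indexAt q.1) q.1 q.2.1 + c₂ • Z.coordChange i (Z.indexAt q.1) q.1 q.2.2)
    have hx : q.1 ∈ Z.baseSet i ∩ Z.baseSet (Z.indexAt q.1) ∩ Z.baseSet i :=
      ⟨⟨hq, Z.mem_baseSet_at q.1⟩, hq⟩
    rw [map_add, map_smul, map_smul, Z.coordChange_comp _ _ _ _ hx, Z.coordChange_comp _ _ _ _ hx,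
      Z.coordChange_self _ _ hq, Z.coordChange_self _ _ hq]
  refine ContinuousAt.congr ?_ hev
  exact ((continuous_const.smul (continuous_fst.comp continuous_snd)).add
    (continuous_const.smul (continuous_snd.comp continuous_snd))).continuousAt

end LinComb


/-! ### The splitting `TM ⊗ ℂ ≅ (TM, J) ⊕ (TM, J)‾` -/

namespace AlmostComplexStructure

variable {E : Type} [NormedAddCommGroup E] [NormedSpace ℝ E] [FiniteDimensional ℝ E]
  {H : Type} [TopologicalSpace H] {I : ModelWithCorners ℝ E H}
  {M : Type} [TopologicalSpace M] [ChartedSpace H M] [IsManifold I 1 M] {n : WithTop ℕ∞}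
  (J : AlmostComplexStructure I n M)

/-- `β_x : T_x M = E ≃ ℂᵏ`, the real-linear identification of the tangent space with the fibre of `(TM, J)` over `x`, intertwining `J_x` and `i` (the inverse of `complexTangentCore_fiberEquiv x`). [cite: McDuffSalamon2017, §2.6] -/
abbrev toFiber (x : M) : E ≃L[ℝ] J.complexTangentCore.Fiber x := (J.complexTangentCore_fiberEquiv x).symm

omit [FiniteDimensional ℝ E] in
/-- `J_x (J_x v) = -v` for the model-valued endomorphism `Jm`. [cite: McDuffSalamon2017, §4.1] -/
theorem Jm_Jm (x : M) (v : E) : J.Jm x (J.Jm x v) = -v := J.map_map x v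

/-- **`β (J v) = i β(v)`**: `β_x` intertwines `J_x` and `i`. [cite: McDuffSalamon2017, §2.6] -/
theorem toFiber_apply_Jm (x : M) (v : E) : J.toFiber x (J.Jm x v) = Complex.I • J.toFiber x v := by
  apply (J.complexTangentCore_fiberEquiv x).injective
  change J.complexTangentCore_fiberEquiv x ((J.complexTangentCore_fiberEquiv x).symm (J.Jm x v)) = _
  rw [complexTangentCore_fiberEquiv_I, ContinuousLinearEquiv.apply_symm_apply,
    ContinuousLinearEquiv.apply_symm_apply]
  rfl

/-- Real scalars act on the fibre `ℂᵏ` through `ℝ ⊂ ℂ`. [folklore] -/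
theorem real_smul_fiber (x : M) (r : ℝ) (y : J.complexTangentCore.Fiber x) : r • y = (r : ℂ) • y := by
  funext k
  simp

/-- **`z • β(e) = β(Re z • e + Im z • J e)`**: under `β` the complex structure of the fibre of `(TM, J)` is `J` (McDuff–Salamon §2.6: `(a + i b) v := a v + b J v`). [cite: McDuffSalamon2017, §2.6] -/
theorem smul_toFiber (x : M) (z : ℂ) (e : E) : z • J.toFiber x e = J.toFiber x (z.re • e + z.im • J.Jm x e) := by
  conv_lhs => rw [← Complex.re_add_im z]
  rw [add_smul, mul_smul, ← toFiber_apply_Jm, ← real_smul_fiber, ← real_smul_fiber, ← map_smul, ← map_smul,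
    ← map_add]

/-- `z • β(e)‾ = β(Re z • e - Im z • J e)‾` in the CONJUGATE fibre: there the complex structure is `-J`. [cite: Hirzebruch1966, proof of Thm. 4.5.1 (p. 66)] -/
theorem smul_toConj_toFiber (x : M) (z : ℂ) (e : E) :
    z • Conj.toConj (J.toFiber x e) = Conj.toConj (J.toFiber x (z.re • e - z.im • J.Jm x e)) := by
  rw [Conj.smul_def, Conj.ofConj_toConj, smul_toFiber, Complex.conj_re, Complex.conj_im, neg_smul,
    sub_eq_add_neg]

/-- `u + i v ↦ β(u + J v) ∈ (T_x M, J)` — the component of `TM ⊗ ℂ → (TM, J)` (complex linear: `i (u + i v) = -v + i u ↦ β(-v + J u) = β(J (u + J v)) = i β(u + J v)`). [cite: Hirzebruch1966, Thm. 4.5.1 (p. 66)] -/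
def splitPlus (x : M) (w : Complexification E) : J.complexTangentCore.Fiber x :=
  J.toFiber x (w.re + J.Jm x w.im)

/-- `u + i v ↦ β(u - J v)‾ ∈ (T_x M, J)‾` — the component of `TM ⊗ ℂ → (TM, J)‾` (complex linear into the conjugate structure). [cite: Hirzebruch1966, Thm. 4.5.1 (p. 66)] -/
def splitMinus (x : M) (w : Complexification E) : Conj (J.complexTangentCore.Fiber x) :=
  Conj.toConj (J.toFiber x (w.re - J.Jm x w.im))

/-- The inverse `(a, b̄) ↦ ½ (β⁻¹ a + β⁻¹ b) + i ½ J (β⁻¹ b - β⁻¹ a)` of the splitting. [cite: Hirzebruch1966, Thm. 4.5.1 (p. 66)] -/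
def splitInv (x : M) (p : J.complexTangentCore.Fiber x × Conj (J.complexTangentCore.Fiber x)) :
    Complexification E :=
  Complexification.mk
    ((2 : ℝ)⁻¹ • (J.complexTangentCore_fiberEquiv x p.1 + J.complexTangentCore_fiberEquiv x (Conj.ofConj p.2)))
    ((2 : ℝ)⁻¹ • J.Jm x (J.complexTangentCore_fiberEquiv x (Conj.ofConj p.2) - J.complexTangentCore_fiberEquiv x p.1))

/-- `splitPlus` is additive. [folklore] -/
theorem splitPlus_add (x : M) (w w' : Complexification E) :
    J.splitPlus x (w + w') = J.splitPlus x w + J.splitPlus x w' := by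
  rw [splitPlus, splitPlus, splitPlus, ← map_add (J.toFiber x)]
  congr 1
  simp only [Complexification.re_add, Complexification.im_add, (J.Jm x).map_add]
  abel

/-- `splitMinus` is additive. [folklore] -/
theorem splitMinus_add (x : M) (w w' : Complexification E) :
    J.splitMinus x (w + w') = J.splitMinus x w + J.splitMinus x w' := by
  rw [splitMinus, splitMinus, splitMinus, ← Conj.toConj_add, ← map_add (J.toFiber x)]
  congr 2
  simp only [Complexification.re_add, Complexification.im_add, (J.Jm x).map_add]
  abel

/-- **`splitPlus` is complex linear** (`J² = -1`). [cite: Hirzebruch1966, Thm. 4.5.1 (p. 66)] -/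
theorem splitPlus_smul (x : M) (z : ℂ) (w : Complexification E) :
    J.splitPlus x (z • w) = z • J.splitPlus x w := by
  rw [splitPlus, splitPlus, smul_toFiber]
  congr 1
  simp only [Complexification.re_smul, Complexification.im_smul, (J.Jm x).map_add,
    (J.Jm x).map_smul, smul_add, Jm_Jm, smul_neg]
  abel

/-- **`splitMinus` is complex linear into the conjugate fibre** (`J² = -1`). [cite: Hirzebruch1966, Thm. 4.5.1 (p. 66)] -/
theorem splitMinus_smul (x : M) (z : ℂ) (w : Complexification E) :
    J.splitMinus x (z • w) = z • J.splitMinus x w := by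
  rw [splitMinus, splitMinus, smul_toConj_toFiber]
  congr 2
  simp only [Complexification.re_smul, Complexification.im_smul, (J.Jm x).map_add, (J.Jm x).map_sub,
    (J.Jm x).map_smul, smul_sub, Jm_Jm, smul_neg]
  abel

/-- **The fibre of `TM ⊗ ℂ` at `x` splits as `(T_x M, J_x) ⊕ (T_x M, J_x)‾`**: the complex-linear isomorphism `u + i v ↦ (β(u + J v), β(u - J v)‾)` (Hirzebruch's unitary change of basis `( iI I ; I -iI )/√2` conjugating the real form of `U(q)` into `diag(A, Ā)`, written without coordinates). [cite: Hirzebruch1966, Thm. 4.5.1 (p. 66)] -/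
def splitEquiv (x : M) :
    Complexification E ≃L[ℂ] (J.complexTangentCore.Fiber x × Conj (J.complexTangentCore.Fiber x)) where
  toFun w := (J.splitPlus x w, J.splitMinus x w)
  invFun := J.splitInv x
  map_add' w w' := Prod.ext (J.splitPlus_add x w w') (J.splitMinus_add x w w')
  map_smul' z w := Prod.ext (J.splitPlus_smul x z w) (J.splitMinus_smul x z w)
  left_inv w := by
    change Complexification.mk _ _ = w
    simp only [splitPlus, splitMinus, Conj.ofConj_toConj, ContinuousLinearEquiv.apply_symm_apply,
      (J.Jm x).map_sub, (J.Jm x).map_add, Jm_Jm]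
    conv_rhs => rw [← Complexification.mk_re_im w]
    congr 1 <;> module
  right_inv p := by
    obtain ⟨a, b⟩ := p
    refine Prod.ext ?_ ?_
    · change J.splitPlus x (Complexification.mk _ _) = a
      trans J.toFiber x (J.complexTangentCore_fiberEquiv x a)
      · rw [splitPlus]
        congr 1
        simp only [Complexification.re_mk, Complexification.im_mk, (J.Jm x).map_smul, Jm_Jm]
        module
      · exact (J.complexTangentCore_fiberEquiv x).symm_apply_apply a
    · change J.splitMinus x (Complexification.mk _ _) = b
      trans Conj.toConj (J.toFiber x (J.complexTangentCore_fiberEquiv x (Conj.ofConj b)))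
      · rw [splitMinus]
        congr 2
        simp only [Complexification.re_mk, Complexification.im_mk, (J.Jm x).map_smul, Jm_Jm]
        module
      · rw [ContinuousLinearEquiv.symm_apply_apply, Conj.toConj_ofConj]
  continuous_toFun := by
    refine Continuous.prodMk ?_ ?_
    · exact (J.toFiber x).continuous.comp
        (Complexification.continuous_re.add ((J.Jm x).continuous.comp Complexification.continuous_im))
    · exact Conj.continuous_toConj.comp ((J.toFiber x).continuous.comp
        (Complexification.continuous_re.sub ((J.Jm x).continuous.comp Complexification.continuous_im)))
  continuous_invFun := by
    have h1 : Continuous fun p : J.complexTangentCore.Fiber x × Conj (J.complexTangentCore.Fiber x) ↦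
        J.complexTangentCore_fiberEquiv x p.1 :=
      (J.complexTangentCore_fiberEquiv x).continuous.comp continuous_fst
    have h2 : Continuous fun p : J.complexTangentCore.Fiber x × Conj (J.complexTangentCore.Fiber x) ↦
        J.complexTangentCore_fiberEquiv x (Conj.ofConj p.2) :=
      (J.complexTangentCore_fiberEquiv x).continuous.comp (Conj.continuous_ofConj.comp continuous_snd)
    refine (Complexification.continuous_iff _).2 ⟨?_, ?_⟩
    · exact (h1.add h2).const_smul _
    · exact ((J.Jm x).continuous.comp (h2.sub h1)).const_smul _

/-- First component of the splitting: `β(u + J v)`. [folklore] -/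
@[simp] theorem splitEquiv_apply_fst (x : M) (w : Complexification E) :
    (J.splitEquiv x w).1 = J.toFiber x (w.re + J.Jm x w.im) := rfl

/-- Second component of the splitting: `β(u - J v)‾`. [folklore] -/
@[simp] theorem splitEquiv_apply_snd (x : M) (w : Complexification E) :
    (J.splitEquiv x w).2 = Conj.toConj (J.toFiber x (w.re - J.Jm x w.im)) := rfl

/-- Real part of the inverse splitting: `½ (β⁻¹ a + β⁻¹ b)`. [folklore] -/
theorem splitEquiv_symm_apply_re (x : M) (p : J.complexTangentCore.Fiber x × Conj (J.complexTangentCore.Fiber x)) :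
    ((J.splitEquiv x).symm p).re =
      (2 : ℝ)⁻¹ • (J.complexTangentCore_fiberEquiv x p.1 + J.complexTangentCore_fiberEquiv x (Conj.ofConj p.2)) := rfl

/-- Imaginary part of the inverse splitting: `½ J (β⁻¹ b - β⁻¹ a)`. [folklore] -/
theorem splitEquiv_symm_apply_im (x : M) (p : J.complexTangentCore.Fiber x × Conj (J.complexTangentCore.Fiber x)) :
    ((J.splitEquiv x).symm p).im =
      (2 : ℝ)⁻¹ • J.Jm x (J.complexTangentCore_fiberEquiv x (Conj.ofConj p.2) - J.complexTangentCore_fiberEquiv x p.1) := rfl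

/-! ### The bundle isomorphism -/

/-- Shorthand: the model fibre `ℂᵏ`, `k = dim M / 2`, of `(TM, J)`. [folklore] -/
abbrev ModelFiber (_J : AlmostComplexStructure I n M) : Type := Fin (finrank ℝ E / 2) → ℂ

/-- `splitPlus (u + i v) = β u + i β v` as a linear combination in the fibre of `(TM, J)`. [folklore] -/
theorem splitPlus_eq (x : M) (w : Complexification E) :
    J.splitPlus x w = (1 : ℂ) • J.toFiber x w.re + Complex.I • J.toFiber x w.im := by
  rw [splitPlus, map_add, toFiber_apply_Jm, one_smul]

/-- `splitMinus (u + i v) = β u - i β v` as a linear combination in the fibre of `(TM, J)`. [folklore] -/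
theorem ofConj_splitMinus_eq (x : M) (w : Complexification E) :
    Conj.ofConj (J.splitMinus x w) = (1 : ℂ) • J.toFiber x w.re + (-Complex.I) • J.toFiber x w.im := by
  rw [splitMinus, Conj.ofConj_toConj, map_sub, toFiber_apply_Jm, one_smul, neg_smul, sub_eq_add_neg]

/-- `β⁻¹` is real-homogeneous for real scalars written in `ℂ`. [folklore] -/
theorem fiberEquiv_real_smul' (x : M) (r : ℝ) (y : J.complexTangentCore.Fiber x) :
    J.complexTangentCore_fiberEquiv x ((r : ℂ) • y) = r • J.complexTangentCore_fiberEquiv x y := by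
  rw [← real_smul_fiber, map_smul]

/-- Real part of the inverse splitting, through the fibre of `(TM, J)`: `β⁻¹ (½ a + ½ b)`. [folklore] -/
theorem splitInv_re_eq (x : M) (p : J.complexTangentCore.Fiber x × Conj (J.complexTangentCore.Fiber x)) :
    (J.splitInv x p).re = J.complexTangentCore_fiberEquiv x ((2⁻¹ : ℂ) • p.1 + (2⁻¹ : ℂ) • Conj.ofConj p.2) := by
  rw [← smul_add, show (2⁻¹ : ℂ) = ((2⁻¹ : ℝ) : ℂ) by norm_num, fiberEquiv_real_smul', map_add]
  rfl

/-- Imaginary part of the inverse splitting, through the fibre of `(TM, J)`: `β⁻¹ (-(i/2) a + (i/2) b)` (`β⁻¹ (i z) = J β⁻¹ z`). [folklore] -/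
theorem splitInv_im_eq (x : M) (p : J.complexTangentCore.Fiber x × Conj (J.complexTangentCore.Fiber x)) :
    (J.splitInv x p).im = J.complexTangentCore_fiberEquiv x
      ((-(2⁻¹ * Complex.I)) • p.1 + (2⁻¹ * Complex.I) • Conj.ofConj p.2) := by
  rw [neg_smul, ← sub_eq_neg_add, ← smul_sub, mul_smul, show (2⁻¹ : ℂ) = ((2⁻¹ : ℝ) : ℂ) by norm_num,
    fiberEquiv_real_smul', complexTangentCore_fiberEquiv_I, map_sub]
  rfl

/-- The pair `(β u, β v)` of a vector `u + i v` of `TM ⊗ ℂ`, as a point of `(TM, J) ×_M (TM, J)`, depends continuously on the vector (through the homeomorphism `(TM, J) ≅ TM`, `tangentHomeomorph`, and the real/imaginary part maps `TM ⊗ ℂ → TM`). [cite: HusemollerFibreBundles1994, Ch. 3 §2] -/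
theorem continuous_pairTotal :
    Continuous fun p : TotalSpace (Complexification.CModel E) (fun x : M ↦ Complexification (TangentSpace I x)) ↦
      (⟨p.proj, (J.toFiber p.proj p.2.re, J.toFiber p.proj p.2.im)⟩ :
        TotalSpace (J.ModelFiber × J.ModelFiber) (fun x ↦ J.complexTangentCore.Fiber x × J.complexTangentCore.Fiber x)) := by
  refine (FiberBundle.Prod.isInducing_diag J.ModelFiber J.complexTangentCore.Fiber
    J.ModelFiber J.complexTangentCore.Fiber).continuous_iff.2 (Continuous.prodMk ?_ ?_)
  · exact J.tangentHomeomorph.symm.continuous.comp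
      (Complexification.continuous_reTotal E (TangentSpace I : M → Type))
  · exact J.tangentHomeomorph.symm.continuous.comp
      (Complexification.continuous_imTotal E (TangentSpace I : M → Type))

/-- The pair `(a, b)` of a point `(a, b̄)` of `(TM, J) ⊕ (TM, J)‾`, as a point of `(TM, J) ×_M (TM, J)`, depends continuously on the point (the conjugate bundle has the same total space, `Conj.totalHomeomorph`). [cite: HusemollerFibreBundles1994, Ch. 3 §2] -/
theorem continuous_unconjTotal :
    Continuous fun q : TotalSpace (J.ModelFiber × Conj J.ModelFiber)
        (fun x ↦ J.complexTangentCore.Fiber x × Conj (J.complexTangentCore.Fiber x)) ↦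
      (⟨q.proj, (q.2.1, Conj.ofConj q.2.2)⟩ :
        TotalSpace (J.ModelFiber × J.ModelFiber) (fun x ↦ J.complexTangentCore.Fiber x × J.complexTangentCore.Fiber x)) := by
  have hd := (FiberBundle.Prod.isInducing_diag J.ModelFiber J.complexTangentCore.Fiber
    (Conj J.ModelFiber) (fun x ↦ Conj (J.complexTangentCore.Fiber x))).continuous
  refine (FiberBundle.Prod.isInducing_diag J.ModelFiber J.complexTangentCore.Fiber
    J.ModelFiber J.complexTangentCore.Fiber).continuous_iff.2 (Continuous.prodMk ?_ ?_)
  · exact continuous_fst.comp hd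
  · exact (Conj.totalHomeomorph J.ModelFiber J.complexTangentCore.Fiber).continuous.comp (continuous_snd.comp hd)

/-- **Hirzebruch's Theorem 4.5.1 for the tangent bundle of an almost complex manifold: `TM ⊗ ℂ ≅ (TM, J) ⊕ (TM, J)‾`** as complex vector bundles — fibrewise `u + i v ↦ (β(u + J v), β(u - J v)‾)` (`splitEquiv`); continuous in both directions since, through `tangentHomeomorph : (TM, J) ≅ TM`, both are fibrewise constant-coefficient linear combinations (`continuous_linComb`). [cite: Hirzebruch1966, Thm. 4.5.1 (p. 66)] -/
def complexifiedTangentSplitting :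
    (complexifiedTangentBundle I M).Iso (J.complexTangentBundle.directSum J.complexTangentBundle.conjugate) where
  equiv x := J.splitEquiv x
  continuous_toFun := by
    refine (FiberBundle.Prod.isInducing_diag J.ModelFiber J.complexTangentCore.Fiber
      (Conj J.ModelFiber) (fun x ↦ Conj (J.complexTangentCore.Fiber x))).continuous_iff.2 (Continuous.prodMk ?_ ?_)
    · have h : (fun p : TotalSpace (Complexification.CModel E) (fun x : M ↦ Complexification (TangentSpace I x)) ↦
          (⟨p.proj, J.splitPlus p.proj p.2⟩ : J.complexTangentCore.TotalSpace)) =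
          (fun q : TotalSpace (J.ModelFiber × J.ModelFiber) (fun x ↦ J.complexTangentCore.Fiber x × J.complexTangentCore.Fiber x) ↦
            (⟨q.proj, (1 : ℂ) • q.2.1 + Complex.I • q.2.2⟩ : J.complexTangentCore.TotalSpace)) ∘
          (fun p ↦ ⟨p.proj, (J.toFiber p.proj p.2.re, J.toFiber p.proj p.2.im)⟩) := by
        funext p
        simp only [comp_apply, splitPlus_eq]
        rfl
      exact (show Continuous fun p : TotalSpace (Complexification.CModel E)
          (fun x : M ↦ Complexification (TangentSpace I x)) ↦
          (⟨p.proj, J.splitPlus p.proj p.2⟩ : J.complexTangentCore.TotalSpace) from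
        h ▸ (J.complexTangentCore.continuous_linComb 1 Complex.I).comp J.continuous_pairTotal)
    · refine (Conj.continuous_total_iff J.ModelFiber J.complexTangentCore.Fiber _).2 ?_
      have h : (fun p : TotalSpace (Complexification.CModel E) (fun x : M ↦ Complexification (TangentSpace I x)) ↦
          Conj.totalHomeomorph J.ModelFiber J.complexTangentCore.Fiber ⟨p.proj, J.splitMinus p.proj p.2⟩) =
          (fun q : TotalSpace (J.ModelFiber × J.ModelFiber) (fun x ↦ J.complexTangentCore.Fiber x × J.complexTangentCore.Fiber x) ↦
            (⟨q.proj, (1 : ℂ) • q.2.1 + (-Complex.I) • q.2.2⟩ : J.complexTangentCore.TotalSpace)) ∘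
          (fun p ↦ ⟨p.proj, (J.toFiber p.proj p.2.re, J.toFiber p.proj p.2.im)⟩) := by
        funext p
        simp only [comp_apply, Conj.totalHomeomorph_apply, ofConj_splitMinus_eq]
        rfl
      exact (show Continuous fun p : TotalSpace (Complexification.CModel E)
          (fun x : M ↦ Complexification (TangentSpace I x)) ↦
          Conj.totalHomeomorph J.ModelFiber J.complexTangentCore.Fiber ⟨p.proj, J.splitMinus p.proj p.2⟩ from
        h ▸ (J.complexTangentCore.continuous_linComb 1 (-Complex.I)).comp J.continuous_pairTotal)
  continuous_invFun := by
    refine (Complexification.continuous_total_iff E (TangentSpace I : M → Type) _).2 ⟨?_, ?_⟩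
    · have h : (fun q : TotalSpace (J.ModelFiber × Conj J.ModelFiber)
          (fun x ↦ J.complexTangentCore.Fiber x × Conj (J.complexTangentCore.Fiber x)) ↦
          Complexification.reTotal E (TangentSpace I : M → Type) ⟨q.proj, (J.splitEquiv q.proj).symm q.2⟩) =
          J.tangentHomeomorph ∘
          (fun q : TotalSpace (J.ModelFiber × J.ModelFiber) (fun x ↦ J.complexTangentCore.Fiber x × J.complexTangentCore.Fiber x) ↦
            (⟨q.proj, (2⁻¹ : ℂ) • q.2.1 + (2⁻¹ : ℂ) • q.2.2⟩ : J.complexTangentCore.TotalSpace)) ∘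
          (fun q ↦ ⟨q.proj, (q.2.1, Conj.ofConj q.2.2)⟩) := by
        funext q
        simp only [comp_apply, tangentHomeomorph_apply_mk, ← splitInv_re_eq]
        rfl
      exact (show Continuous fun q : TotalSpace (J.ModelFiber × Conj J.ModelFiber)
          (fun x ↦ J.complexTangentCore.Fiber x × Conj (J.complexTangentCore.Fiber x)) ↦
          Complexification.reTotal E (TangentSpace I : M → Type) ⟨q.proj, (J.splitEquiv q.proj).symm q.2⟩ from
        h ▸ J.tangentHomeomorph.continuous.comp
          ((J.complexTangentCore.continuous_linComb _ _).comp J.continuous_unconjTotal))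
    · have h : (fun q : TotalSpace (J.ModelFiber × Conj J.ModelFiber)
          (fun x ↦ J.complexTangentCore.Fiber x × Conj (J.complexTangentCore.Fiber x)) ↦
          Complexification.imTotal E (TangentSpace I : M → Type) ⟨q.proj, (J.splitEquiv q.proj).symm q.2⟩) =
          J.tangentHomeomorph ∘
          (fun q : TotalSpace (J.ModelFiber × J.ModelFiber) (fun x ↦ J.complexTangentCore.Fiber x × J.complexTangentCore.Fiber x) ↦
            (⟨q.proj, (-(2⁻¹ * Complex.I)) • q.2.1 + (2⁻¹ * Complex.I) • q.2.2⟩ : J.complexTangentCore.TotalSpace)) ∘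
          (fun q ↦ ⟨q.proj, (q.2.1, Conj.ofConj q.2.2)⟩) := by
        funext q
        simp only [comp_apply, tangentHomeomorph_apply_mk, ← splitInv_im_eq]
        rfl
      exact (show Continuous fun q : TotalSpace (J.ModelFiber × Conj J.ModelFiber)
          (fun x ↦ J.complexTangentCore.Fiber x × Conj (J.complexTangentCore.Fiber x)) ↦
          Complexification.imTotal E (TangentSpace I : M → Type) ⟨q.proj, (J.splitEquiv q.proj).symm q.2⟩ from
        h ▸ J.tangentHomeomorph.continuous.comp
          ((J.complexTangentCore.continuous_linComb _ _).comp J.continuous_unconjTotal))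

/-! ### `p₁(TM) = c₁(TM, J)² - 2 c₂(TM, J)` -/

/-- Composition of degree casts. [folklore] -/
theorem degCast_degCast' {X : Type} [TopologicalSpace X] {a b c : ℕ} (e₁ : a = b) (e₂ : b = c)
    (y : singularCohomology ℤ ℤ X a) : degCast ℤ e₂ (degCast ℤ e₁ y) = degCast ℤ (e₁.trans e₂) y := by
  subst e₁; subst e₂; rfl

/-- A degree cast of a cup product is the cup product with the cast degree identity. [folklore] -/
theorem degCast_cupProduct' {X : Type} [TopologicalSpace X] {p q m m' : ℕ} (h : p + q = m) (e : m = m')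
    (y : singularCohomology ℤ ℤ X p) (z : singularCohomology ℤ ℤ X q) :
    degCast ℤ e (cupProduct h y z) = cupProduct (h.trans e) y z := by
  subst e; rfl

/-- **`c₂(TM ⊗ ℂ) = 2 c₂(TM, J) - c₁(TM, J)²`** — the Whitney sum formula for
`TM ⊗ ℂ ≅ (TM, J) ⊕ (TM, J)‾` with `c₁(ξ̄) = -c₁(ξ)`, `c₂(ξ̄) = c₂(ξ)` (Hirzebruch Thm. 4.5.1:
`1 - p₁ + p₂ - ⋯ = (1 + c₁ + c₂ + ⋯)(1 - c₁ + c₂ - ⋯)`, degree `4`). [cite: Hirzebruch1966, Thm. 4.5.1 (p. 66)] -/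
theorem chernClassZ_two_complexifiedTangentBundle [T2Space M] [ParacompactSpace M] :
    chernClassZ (complexifiedTangentBundle I M) 2 =
      J.chernClass 2 + J.chernClass 2 - cupEven (show 1 + 1 = 2 from rfl) (J.chernClass 1) (J.chernClass 1) := by
  have h1 := theChernClassTheory.chernClass_congr J.complexifiedTangentSplitting 2
  have h2 := theChernClassTheory.chernClass_directSum J.complexTangentBundle J.complexTangentBundle.conjugate 2
  have hu : (Finset.univ : Finset (Finset.HasAntidiagonal.antidiagonal 2)) =
      {⟨(0, 2), by simp⟩, ⟨(1, 1), by simp⟩, ⟨(2, 0), by simp⟩} := by decide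
  rw [hu, Finset.sum_insert (by decide), Finset.sum_pair (by decide)] at h2
  refine (h1.trans h2).trans ?_
  change cupEven _ (chernClassZ _ 0) (chernClassZ _ 2) +
    (cupEven _ (chernClassZ _ 1) (chernClassZ _ 1) + cupEven _ (chernClassZ _ 2) (chernClassZ _ 0)) = _
  rw [chernClassZ_zero, chernClassZ_zero, chernClassZ_conjugate_two, chernClassZ_conjugate_one, map_neg]
  have e1 : cupEven (show 0 + 2 = 2 from rfl) (singularCohomology.one ℤ M) (chernClassZ J.complexTangentBundle 2) =
      chernClassZ J.complexTangentBundle 2 := one_cupProduct _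
  have e2 : cupEven (show 2 + 0 = 2 from rfl) (chernClassZ J.complexTangentBundle 2) (singularCohomology.one ℤ M) =
      chernClassZ J.complexTangentBundle 2 := cupProduct_one _
  rw [e1, e2]
  change J.chernClass 2 + (-cupEven _ (J.chernClass 1) (J.chernClass 1) + J.chernClass 2) = _
  abel

/-- **`p₁(M) = c₁(TM, J)² - 2 c₂(TM, J) ∈ H⁴(M; ℤ)` for an almost complex manifold** (Hirzebruch
1966, Thm. 4.5.1 with §4.6: the Pontrjagin classes of the underlying real bundle of a `U(q)`-bundle,
`p₁ = c₁² - 2 c₂`), over a paracompact Hausdorff base. [cite: Hirzebruch1966, Thm. 4.5.1 (p. 66)] -/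
theorem tangentPontryaginClass_one_eq [T2Space M] [ParacompactSpace M] :
    degCast ℤ (show 4 * 1 = 4 by norm_num) (tangentPontryaginClass I M 1) =
      cupProduct two_add_two_eq_four J.firstChernClass J.firstChernClass
        - (2 : ℤ) • degCast ℤ (show 2 * 2 = 4 by norm_num) (J.chernClass 2) := by
  rw [firstChernClass, cupProduct_degCast_left ℤ _ _ (show 2 * 1 + 2 = 4 by norm_num),
    cupProduct_degCast_right ℤ _ _ (show 2 * 1 + 2 * 1 = 4 by norm_num)]
  change degCast ℤ (show 4 * 1 = 4 by norm_num) ((-1 : ℤ) ^ 1 • degCast ℤ (show 2 * 2 = 4 * 1 by norm_num)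
    (chernClassZ (complexifiedTangentBundle I M) 2)) = _
  rw [J.chernClassZ_two_complexifiedTangentBundle, pow_one, neg_one_zsmul, map_neg, degCast_degCast',
    map_sub, map_add, degCast_cupProduct']
  abel

end AlmostComplexStructure

end Literature.Geometry.Symplectic
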